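import Literature.AlgebraicGeometry.Frobenioids.Thm36SubProofs2
import HarnessLib

/-!
# Frobenioids II, Example 3.3 (ii): `C^ℝ := C^rlf` as a completion datum (`rlfCompletion`)

Mochizuki, *The geometry of Frobenioids II*, Kyushu J. Math. **62** (2008) 401–460, §3, Example 3.3 (ii)
p. 28: "`C^ℤ := C`; `C^ℚ := C^pf`; `C^ℝ := C^rlf` [cf. [Mzk5], Proposition 5.3]".  The interface
`ArchFrd.LambdaCompletion π` (`AngularFrobenioidsRelative.lean`, seat abc-iut-L1-t6) asks for a category with
a pre-Frobenioid structure over `D` AND the natural functor from `C` lying over `D` on the nose; for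
`C^ℚ` this is `Thm36Sub.pfCompletion` (`Thm36Sub.lean`).  This file supplies the `C^ℝ`-datum
`ArchFrd.Thm36Sub.rlfCompletion π` over THE realification `C^rlf` ([FrdI] Prop. 5.3: the model Frobenioid of
`(Φ^rlf, ℝ · Φ^birat)`, `PreFrobenioid.rlf`, seat abc-iut-L1-d2): the functor `C → C^rlf` is the model
description `Y ↦ (Y_D, 0)`, `f ↦ (deg_Fr f, Base f, ι(Div f), ι(Div f))` (`ι : Φ → Φ^pf → Φ^rlf`) of the
composite `C → C^un-tr → C^rlf` of [FrdI] Prop. 5.3 — available as a functor ON objects of `C` because for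
the archimedean Frobenioid `ℝ · Φ^birat = (Φ^rlf)^gp` (`Thm36Sub.realSpan_carrier_eq_top`), so that every
`ι(Div f)` IS a "rational function" (this is why the datum lives here and not in `Thm36Sub.lean`, which
`Thm36SubProofs2` imports).  With it, t9's `Λ`-indexed instance statements
(`ArchimedeanTheoremsInstances.lean`) at `(pf, rlf) := (pfCompletion hF, rlfCompletion π)` have as
`Λ = ℝ` conjuncts EXACTLY the `…_R` slots of `Thm36Sub.lean` (`rfl` bridges below).  Definitions +
definitional bridges only; no statement of the paper is re-typed; no side taken on [IUTchIII] Cor. 3.12.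
Seat abc-iut-w4-d074 (cell abc-iut, L1 row M13-b).
-/

noncomputable section

namespace Literature.AlgebraicGeometry.Frobenioids

open CategoryTheory Opposite Literature.AnabelianGeometry.EtaleTheta
open scoped NNReal

universe v u

namespace ArchFrd

variable {D : Type u} [Category.{v} D] (π : D ⥤ D0)

namespace Thm36Sub

/-- `ι_X : Φ(X) → Φ^rlf(X)`, the component at `X` of `Φ → Φ^pf → Φ^rlf` for THE realification datum.
[cite: MochizukiFrdI2008, Prop. 5.3 p.103] -/
abbrev toRlfHom (X : D) :
    (Φ π).obj (op X) →*
      (RealificationData.canonical (Φ π)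
        (PreFrobenioid.IsPerfFactorialOn.op (isPerfFactorialOn_Φ π))).rlf.obj (op X) :=
  ((RealificationData.canonical (Φ π)
    (PreFrobenioid.IsPerfFactorialOn.op (isPerfFactorialOn_Φ π))).toRlf.app (op X)).hom

/-- Naturality of `ι : Φ → Φ^rlf` against the pull-back maps: `ι_X (Φ(f) d) = Φ^rlf(f) (ι_Y d)`.
[cite: MochizukiFrdI2008, Prop. 5.3 p.103] -/
theorem toRlfHom_pull {X Y : D} (f : X ⟶ Y) (d : (Φ π).obj (op Y)) :
    toRlfHom π X (pull (Φ π) f d) =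
      ((RealificationData.canonical (Φ π)
          (PreFrobenioid.IsPerfFactorialOn.op (isPerfFactorialOn_Φ π))).rlf.map f.op).hom
        (toRlfHom π Y d) := by
  have h := (RealificationData.canonical (Φ π)
    (PreFrobenioid.IsPerfFactorialOn.op (isPerfFactorialOn_Φ π))).toRlf.naturality f.op
  exact congrArg (fun g => (CommMonCat.Hom.hom g) d) h

/-- Every `(Φ^rlf)^gp`-class is a "rational function" of `C^rlf` (`ℝ · Φ^birat = (Φ^rlf)^gp`); private copy of
`Thm36Sub.mem_realSpan` (`Thm36SubIndissectR.lean`, seat abc-iut-L1-d5), kept local to avoid the import.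
[cite: MochizukiFrdI2008, Prop. 5.3 p.103] -/
private theorem mem_realSpan_aux (X : D)
    (c : Algebra.GrothendieckGroup ((RealificationData.canonical (Φ π)
        (PreFrobenioid.IsPerfFactorialOn.op (isPerfFactorialOn_Φ π))).rlf.obj (op X))) :
    c ∈ ((RealificationData.canonical (Φ π)
          (PreFrobenioid.IsPerfFactorialOn.op (isPerfFactorialOn_Φ π))).realSpan
        (PreFrobenioid.biratSubfunctor (C.toElem π))).carrier X := by
  rw [realSpan_carrier_eq_top]; exact Subgroup.mem_top _

/-- The image `(deg_Fr f, Base f, ι(Div f), ι(Div f)) : (B_D, 0) → (A_D, 0)` in `C^rlf` of a morphism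
`f : B → A` of `C`. [cite: MochizukiFrdII2008, Ex 3.3 (ii) p.28] -/
def toRlfMap {Y Y' : C π} (f : Y ⟶ Y') :
    ((⟨PreFrobenioid.baseObj (C.toElem π) Y, 1⟩ : rlfCat π) ⟶ ⟨PreFrobenioid.baseObj (C.toElem π) Y', 1⟩) :=
  ⟨PreFrobenioid.degFr (C.toElem π) f, PreFrobenioid.Base (C.toElem π) f,
    toRlfHom π (PreFrobenioid.baseObj (C.toElem π) Y) (PreFrobenioid.Div (C.toElem π) f),
    ⟨Algebra.GrothendieckGroup.of
        (toRlfHom π (PreFrobenioid.baseObj (C.toElem π) Y) (PreFrobenioid.Div (C.toElem π) f)),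
      mem_realSpan_aux π _ _⟩, by
    rw [one_pow, one_mul, map_one, one_mul]
    rfl⟩

/-- `deg_Fr` of the image. [cite: MochizukiFrdII2008, Ex 3.3 (ii) p.28] -/
@[simp] theorem degFr_toRlfMap {Y Y' : C π} (f : Y ⟶ Y') :
    ModelFrobenioid.degFr (toRlfMap π f) = PreFrobenioid.degFr (C.toElem π) f := rfl

/-- `Base` of the image. [cite: MochizukiFrdII2008, Ex 3.3 (ii) p.28] -/
@[simp] theorem baseMap_toRlfMap {Y Y' : C π} (f : Y ⟶ Y') :
    ModelFrobenioid.baseMap (toRlfMap π f) = PreFrobenioid.Base (C.toElem π) f := rfl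

/-- `Div` of the image is `ι(Div f)`. [cite: MochizukiFrdII2008, Ex 3.3 (ii) p.28] -/
@[simp] theorem div_toRlfMap {Y Y' : C π} (f : Y ⟶ Y') :
    ModelFrobenioid.div (toRlfMap π f) =
      toRlfHom π (PreFrobenioid.baseObj (C.toElem π) Y) (PreFrobenioid.Div (C.toElem π) f) := rfl

/-- `u` of the image is (the class of) `ι(Div f)`. [cite: MochizukiFrdII2008, Ex 3.3 (ii) p.28] -/
@[simp] theorem coe_unit_toRlfMap {Y Y' : C π} (f : Y ⟶ Y') :
    (ModelFrobenioid.unit (toRlfMap π f)).1 =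
      Algebra.GrothendieckGroup.of
        (toRlfHom π (PreFrobenioid.baseObj (C.toElem π) Y) (PreFrobenioid.Div (C.toElem π) f)) := rfl

/-- **The functor `C → C^ℝ = C^rlf`** of Example 3.3 (ii) ([FrdI] Prop. 5.3's `C → C^un-tr → C^rlf` in its
model description): `Y ↦ (Y_D, 0)`, `f ↦ (deg_Fr f, Base f, ι(Div f), ι(Div f))`.
[cite: MochizukiFrdII2008, Ex 3.3 (ii) p.28] -/
def toRlfFunctor : C π ⥤ rlfCat π where
  obj Y := ⟨PreFrobenioid.baseObj (C.toElem π) Y, 1⟩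
  map f := toRlfMap π f
  map_id Y := by
    apply ModelFrobenioid.hom_ext
    · exact PreFrobenioid.degFr_id (C.toElem π) Y
    · exact PreFrobenioid.base_id (C.toElem π) Y
    · change toRlfHom π _ (PreFrobenioid.Div (C.toElem π) (𝟙 Y)) = 1
      rw [PreFrobenioid.div_id, map_one]
    · apply Subtype.ext
      change Algebra.GrothendieckGroup.of (toRlfHom π _ (PreFrobenioid.Div (C.toElem π) (𝟙 Y))) = 1
      rw [PreFrobenioid.div_id, map_one, map_one]
  map_comp f g := by
    apply ModelFrobenioid.hom_ext
    · change PreFrobenioid.degFr (C.toElem π) (f ≫ g) =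
        PreFrobenioid.degFr (C.toElem π) g * PreFrobenioid.degFr (C.toElem π) f
      rw [PreFrobenioid.degFr_comp, mul_comm]
    · exact PreFrobenioid.base_comp (C.toElem π) f g
    · change toRlfHom π _ (PreFrobenioid.Div (C.toElem π) (f ≫ g)) =
        ((RealificationData.canonical (Φ π)
            (PreFrobenioid.IsPerfFactorialOn.op (isPerfFactorialOn_Φ π))).rlf.map
          (PreFrobenioid.Base (C.toElem π) f).op).hom
          (toRlfHom π _ (PreFrobenioid.Div (C.toElem π) g)) *
        toRlfHom π _ (PreFrobenioid.Div (C.toElem π) f) ^ (PreFrobenioid.degFr (C.toElem π) g : ℕ)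
      rw [PreFrobenioid.div_comp, map_mul, map_pow, toRlfHom_pull]
    · apply Subtype.ext
      change Algebra.GrothendieckGroup.of (toRlfHom π _ (PreFrobenioid.Div (C.toElem π) (f ≫ g))) =
        pullGp _ (PreFrobenioid.Base (C.toElem π) f)
          (Algebra.GrothendieckGroup.of (toRlfHom π _ (PreFrobenioid.Div (C.toElem π) g))) *
        Algebra.GrothendieckGroup.of (toRlfHom π _ (PreFrobenioid.Div (C.toElem π) f)) ^
          (PreFrobenioid.degFr (C.toElem π) g : ℕ)
      rw [PreFrobenioid.div_comp, map_mul, map_pow, toRlfHom_pull, map_mul, map_pow, pullGp_of]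

/-- `C → C^rlf` lies over `D` on the nose. [cite: MochizukiFrdII2008, Ex 3.3 (ii) p.28] -/
theorem toRlfFunctor_comp_baseFunctor :
    toRlfFunctor π ⋙ PreFrobenioid.baseFunctor (rlfStr π) = C.toBase π := rfl

/-- **`C^ℝ := C^rlf` as a completion datum** of the interface `LambdaCompletion π`: THE realification
([FrdI] Prop. 5.3), its structure functor `(deg_Fr, Base, Div)` over `Φ^rlf`, the functor `C → C^rlf` and the
on-the-nose compatibility over `D`. [cite: MochizukiFrdII2008, Ex 3.3 (ii) p.28] -/
def rlfCompletion : LambdaCompletion π where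
  cat := rlfCat π
  monoid := (RealificationData.canonical (Φ π)
    (PreFrobenioid.IsPerfFactorialOn.op (isPerfFactorialOn_Φ π))).rlf
  str := rlfStr π
  fromC := toRlfFunctor π
  over := toRlfFunctor_comp_baseFunctor π

/-- With `rlf := rlfCompletion`, the `Λ = ℝ` member of t9's family `archFrobenioid π pf rlf` IS THE realification
(definitionally). [cite: MochizukiFrdII2008, Ex 3.3 (ii) p.28] -/
@[simp] theorem archFrobenioid_rlfCompletion_R (pf : LambdaCompletion π) :
    archFrobenioid π pf (rlfCompletion π) .R = rlfCompletion π := rfl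

/-- … so its structure functor is `rlfStr` … [cite: MochizukiFrdII2008, Ex 3.3 (ii) p.28] -/
theorem archFrobenioid_rlfCompletion_R_str (pf : LambdaCompletion π) :
    (archFrobenioid π pf (rlfCompletion π) .R).str = rlfStr π := rfl

/-- … and its category is `rlfCat`. [cite: MochizukiFrdII2008, Ex 3.3 (ii) p.28] -/
theorem archFrobenioid_rlfCompletion_R_cat (pf : LambdaCompletion π) :
    (archFrobenioid π pf (rlfCompletion π) .R).cat = rlfCat π := rfl

end Thm36Sub

end ArchFrd

end Literature.AlgebraicGeometry.Frobenioids
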